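import Summits.RiemannHypothesis.RiemannHypothesis.Theses.WeilComb
import Summits.RiemannHypothesis.RiemannHypothesis.Theorems.CombShapePositivity.Negative.WeilCombCombShapePositivityLoadBearing
import Summits.RiemannHypothesis.RiemannHypothesis.Theorems.WeilCombCombShapePositivityStubWindowNorm
import Summits.RiemannHypothesis.RiemannHypothesis.Theorems.WeilCombCombShapeAdmissible
import Literature.NumberTheory.LFunctions.WeilExplicit
import Literature.NumberTheory.LFunctions.WeilMellinBounds
import Literature.NumberTheory.LFunctions.WeilArchimedeanMoments
import Literature.NumberTheory.LFunctions.WeilArchimedeanPositivityProofs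
import Literature.Analysis.SpecialFunctions.DigammaVerticalSeries

/-!
# The archimedean term of the fixed-shape comb on the window, Plancherel form
(crux `WeilComb.CombShapePositivity`, item stmt-RiemannHypothesis-11229, line `Sketch`; stub `stub_arch_window`
(B4) of Theorem B = `2ε(M+1) ≤ 1 ⇒ 0 ≤ Re Q(comb)`)

Notation: `φ₀(u) = expNegInvGlue (1 - u²)` (the route's fixed bump), `φ_ε(t) = ε⁻¹ φ₀(t/ε)`,
comb `g(x) = Σ_{1 ≤ m ≤ M} a_m φ_ε(x − log m)`, `k = g ⋆ g̃`, `ρ(u) = Re ψ(1/4 + iu/2)`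
(`Literature.Analysis.SpecialFunctions.reDigammaQuarter`).

**Statement.** For `ε > 0`, `M`, `a` with `2ε(M+1) ≤ 1`:
`Re W_∞(k) = (1/2π) ∫ |ĝ(1/2+iu)|² (ρ(u) − ρ(0)) du + (ρ(0) − log π) · ε⁻¹ ‖φ₀‖₂² · Σ_{m ≤ M} |a_m|²`.

**Proof.** For ANY Weil test `g`: `W_∞(k) = (1/2π) ∫ k̂(1/2+iu) ρ(u) du − k(0) log π` (definition of
`weilArchTerm`), `k̂(1/2+iu) = |ĝ(1/2+iu)|²` (`weilArchIntegral_weilConv_weilReflect`), `k(0) = ‖g‖₂²`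
(`weilConv_weilReflect_apply_zero`), and `∫ |ĝ|² ρ = ∫ |ĝ|² (ρ − ρ(0)) + ρ(0) · 2π ‖g‖₂²` (Plancherel,
`integral_norm_sq_weilMellin_half_line`); this gives `Re W_∞(k) = (1/2π) ∫ |ĝ|²(ρ − ρ(0)) + (ρ(0) − log π)‖g‖₂²`.
On the window the translates `φ_ε(· − log m)` are pairwise orthogonal, `‖g‖₂² = ε⁻¹ ‖φ₀‖₂² Σ |a_m|²`
(the landed window norm identity `stub_windowNorm`).
-/

noncomputable section

-- the sub-problem path RiemannHypothesis/RiemannHypothesis duplicates a namespace (D-0017)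
set_option linter.dupNamespace false

open scoped BigOperators ComplexConjugate
open Complex MeasureTheory Set

namespace Summit.RiemannHypothesis.RiemannHypothesis.Theorems.WeilCombBohrFejer

open Literature.NumberTheory.LFunctions
open Literature.Analysis.SpecialFunctions (reDigammaQuarter)

/-- Plancherel form of the archimedean term of an autocorrelation `k = g ⋆ g̃`, for any Weil test `g`:
`Re W_∞(k) = (1/2π) ∫ |ĝ(1/2+iu)|² (ρ(u) − ρ(0)) du + (ρ(0) − log π) ‖g‖₂²`. -/
private theorem weilArchTerm_weilConv_weilReflect_re_archWindow {g : ℝ → ℂ} (hg : IsWeilTest g) :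
    (weilArchTerm (weilConv g (weilReflect g))).re =
      1 / (2 * Real.pi) * (∫ u : ℝ, ‖weilMellin g (1 / 2 + u * I)‖ ^ 2 *
          (reDigammaQuarter u - reDigammaQuarter 0)) +
        (reDigammaQuarter 0 - Real.log Real.pi) * weilNorm2Sq g := by
  -- `k(0) = ‖g‖₂²`
  have h0 : weilConv g (weilReflect g) 0 = ((weilNorm2Sq g : ℝ) : ℂ) :=
    weilConv_weilReflect_apply_zero g
  set N2 : ℝ := weilNorm2Sq g with hN2
  set A : ℝ := ∫ u : ℝ, ‖weilMellin g (1 / 2 + u * I)‖ ^ 2 * reDigammaQuarter u with hA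
  -- `Re W_∞(k) = (1/2π) A − ‖g‖₂² log π`
  have harch : (weilArchTerm (weilConv g (weilReflect g))).re =
      1 / (2 * Real.pi) * A - N2 * Real.log Real.pi := by
    have e : weilArchTerm (weilConv g (weilReflect g)) =
        ((1 / (2 * Real.pi) * A - N2 * Real.log Real.pi : ℝ) : ℂ) := by
      unfold weilArchTerm
      rw [weilArchIntegral_weilConv_weilReflect hg, h0]
      push_cast
      simp only [reDigammaQuarter] at hA
      rw [hA]
    rw [e, Complex.ofReal_re]
  -- split off `ρ(0)` and use Plancherel `∫ |ĝ(1/2+iu)|² du = 2π ‖g‖₂²`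
  have hI1 : Integrable fun u : ℝ => ‖weilMellin g (1 / 2 + u * I)‖ ^ 2 :=
    integrable_norm_sq_weilMellin_half_line hg
  have hI0 : Integrable fun u : ℝ => ‖weilMellin g (1 / 2 + u * I)‖ ^ 2 * reDigammaQuarter u :=
    integrable_norm_sq_weilMellin_mul_reDigammaQuarter hg
  have hP : ∫ u : ℝ, ‖weilMellin g (1 / 2 + u * I)‖ ^ 2 = 2 * Real.pi * N2 :=
    integral_norm_sq_weilMellin_half_line hg
  have hB : ∫ u : ℝ, ‖weilMellin g (1 / 2 + u * I)‖ ^ 2 * (reDigammaQuarter u - reDigammaQuarter 0) =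
      A - reDigammaQuarter 0 * (2 * Real.pi * N2) := by
    rw [← hP, ← integral_const_mul, ← integral_sub hI0 (hI1.const_mul _)]
    congr 1 with u
    ring
  have hπ : (2 * Real.pi) ≠ 0 := by positivity
  rw [harch, hB]
  field_simp
  ring

/-- **Stub B4 — the archimedean term of the comb on the window, Plancherel form.** For `0 < ε`,
`2ε(M+1) ≤ 1`: `Re W_∞(g ⋆ g̃) = (1/2π) ∫ |ĝ(1/2+iu)|² (ρ(u) − ρ(0)) du + (ρ(0) − log π) · ε⁻¹‖φ₀‖₂² · ‖a‖²`,
`ρ(u) = Re ψ(1/4 + iu/2)`: `W_∞(k) = (1/2π)∫ k̂(1/2+iu) ρ(u) du − k(0) log π`, `k̂(1/2+iu) = |ĝ(1/2+iu)|²`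
(`weilArchIntegral_weilConv_weilReflect`), Plancherel `∫|ĝ|² = 2π‖g‖₂²`, and on the window the translates
`φ_ε(· − log m)` are pairwise orthogonal (`|log m − log m'| > 1/(M+1) ≥ 2ε`), so `k(0) = ‖g‖₂² = ε⁻¹‖φ₀‖₂²‖a‖²`
(`stub_windowNorm`). [folklore] -/
theorem stub_arch_window : ∀ ε : ℝ, 0 < ε → ∀ (M : ℕ) (a : ℕ → ℂ), 2 * ε * ((M : ℝ) + 1) ≤ 1 →
    (weilArchTerm
      (weilConv (fun x : ℝ => ∑ m ∈ Finset.Icc 1 M,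
          a m * ((ε : ℂ)⁻¹ * ((expNegInvGlue (1 - ((x - Real.log (m : ℝ)) / ε) ^ 2) : ℝ) : ℂ)))
        (weilReflect (fun x : ℝ => ∑ m ∈ Finset.Icc 1 M,
          a m * ((ε : ℂ)⁻¹ * ((expNegInvGlue (1 - ((x - Real.log (m : ℝ)) / ε) ^ 2) : ℝ) : ℂ)))))).re =
      1 / (2 * Real.pi) * (∫ u : ℝ, ‖weilMellin (fun x : ℝ => ∑ m ∈ Finset.Icc 1 M,
          a m * ((ε : ℂ)⁻¹ * ((expNegInvGlue (1 - ((x - Real.log (m : ℝ)) / ε) ^ 2) : ℝ) : ℂ)))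
            (1 / 2 + u * I)‖ ^ 2 * (reDigammaQuarter u - reDigammaQuarter 0)) +
        (reDigammaQuarter 0 - Real.log Real.pi) *
          (ε⁻¹ * weilNorm2Sq (fun u : ℝ => ((expNegInvGlue (1 - u ^ 2) : ℝ) : ℂ)) *
            ∑ m ∈ Finset.Icc 1 M, ‖a m‖ ^ 2) := by
  intro ε hε M a hw
  rw [← stub_windowNorm ε hε M a hw]
  exact weilArchTerm_weilConv_weilReflect_re_archWindow
    (Summit.RiemannHypothesis.RiemannHypothesis.Theorems.weilComb_shapeComb_isWeilTest ε M a)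

end Summit.RiemannHypothesis.RiemannHypothesis.Theorems.WeilCombBohrFejer

end
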